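import Literature.NumberTheory.IwasawaTheory.PSCyclotomicLFunction
import Literature.NumberTheory.EllipticCurves.PAdicTwoVariableTransformUnits
import Literature.NumberTheory.EllipticCurves.PAdicLFunctionDistributionProofs
import HarnessLib

/-!
# Untwist eigensymbols, I: the Mazur–Tate–Teitelbaum ball values and their twisted push-forward to `Γ`
# (additivity and growth of order `½` in the currency of D1 `IsUntwistedPAdicLFunction`)

Cell `pub/bsd-wall` (D-0145 line `route-BirchSwinnertonDyer-CyclotomicUntwist`), seat `bsd-line-cycu-p3`
(prover seat 3/3), helper toward crux K1 `PSRankOneLowerHalfAtThree` (stmt-BirchSwinnertonDyer-21580) —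
toward its EXISTENCE want F1 (`wi-84943`: "`∃ 𝓛, IsPSCyclotomicLFunctionOf W η α 𝓛`").  First of three files
(`…EigensymbolPushforward` → `…EigensymbolCharValues` → `…UntwistedLFunctionExistence`); the main theorem
and the full narrative are in the third.  THEOREMS ONLY (no definition, no named fact, no `sorry`).  BSD is
not proved by this file and no crux of the route is proved by it.

SETTING. `p` a prime, `η` a Dirichlet character mod `p^c` with values in `ℂ_p`, `α ∈ ℂ_p`, and an UNTWIST
EIGENSYMBOL `Φ : ℚ → ℂ_p` (intended: `r ↦ τ(η){∞, r}⁺_g/Ω⁺_f` for the newform `g` of `f ⊗ η̄`, `U_p g = αg`,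
Mazur–Tate–Teitelbaum 1986 §I.14 "`p ∣ N`, `a_p ≠ 0`"), of which this file uses (S2) `∑_{j mod p} Φ((r+j)/p)
= α Φ(r)` and (S4) `‖Φ‖ ≤ C`.  The constructed systems are written as HYPOTHESIS-EQUATIONS on function
variables (the tree's idiom for a construction without a `def`, cf. `PAdicMeasureTransform`):
`hν : ν L a = α^{-L} Φ(a/p^L)` (the distribution of the allowable root `α`, MTT §I.10) and
`hL : L n s = ∑_ζ ∑_{b mod p^{n+e₀+c}, b ≡ ζγ^s (p^{n+e₀})} η(b)⁻¹ ν(b + p^{n+e₀+c}ℤ_p)` — the push-forward of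
`η̄ · ν|_{ℤ_p^×}` to `Γ = 1 + p^{e₀}ℤ_p` along `x ↦ ⟨x⟩`, in the level-`n` ball encoding of D1 (`γ^sΓ^{pⁿ}`
pulls back to `⊔_ζ (ζγ^s + p^{n+e₀}ℤ_p)` over the Teichmüller representatives `ζ`, tree `classOf`), resolved
at level `p^{n+e₀+c}` where `η` is constant.

CONTENTS. §1 `sum_fiber_symbolMeasure_succ`: (S2) ⟹ `ν` satisfies the distribution relation (MTT §I.10 Prop.
(10.2), `ε(p) = 0`), with the iterated relation and the unit-level descent for any value group (the tree's
`sum_fiber_of_distribution` / `sum_units_mul_of_distribution`, verbatim for general values); §2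
`isGammaDistribution_pushforward`: `L` is additive (`IsGammaDistribution`) for ANY distribution `ν` (the
sub-balls pull back to the lifts of the Teichmüller classes — tree `castHom_classOf`, `exists_lift_classOf`);
§3 `hasGrowthOrder_pushforward`: (S4) and `‖α⁻¹‖ ≤ √p` give `HasGrowthOrder p (1/2) L` (ultrametric
inequality; `‖η(b)⁻¹‖ ≤ 1`).  Templates: the tree's `PAdicLFunctionInterpolationProofs` (good ordinary `p`)
and `PAdicMeasureTransform` (abstract distributions).

References: [cite: MazurTateTeitelbaum1986Invent, §I.10–§I.11 and §I.13] · [cite: Bellaiche2021, §6.7.2–§6.7.3, Def. 6.2.10].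
-/

noncomputable section

open Finset
open Literature.NumberTheory.EllipticCurves Literature.NumberTheory.EllipticCurves.ModularForms
  Literature.NumberTheory.IwasawaTheory

-- single-conjunct summit: `Summit.BirchSwinnertonDyer.BirchSwinnertonDyer.…` repeats the name by design
set_option linter.dupNamespace false

namespace Summit.BirchSwinnertonDyer.BirchSwinnertonDyer.Theorems.PSUntwistExistence

variable {p : ℕ} [Fact p.Prime]

/-! ### §1 The ball values `ν(a + p^L ℤ_p) = α^{-L} Φ(a/p^L)` of an eigensymbol form a distribution -/

/-- **Iterated distribution relation** (any additive target): from the one-step relation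
`∑_{b ≡ a (pⁿ)} ν(b + p^{n+1}ℤ_p) = ν(a + pⁿℤ_p)` to `∑_{b ≡ a (pⁿ)} ν(b + p^Lℤ_p) = ν(a + pⁿℤ_p)` for all
`n ≤ L` (Mazur–Tate–Teitelbaum 1986, §I.11 (11.1); the tree's `sum_fiber_of_distribution` for
`ℚ_p`-values, verbatim for any additive monoid). [cite: MazurTateTeitelbaum1986Invent, §I.11] -/
theorem sum_fiber_of_distribution' {M : Type*} [AddCommMonoid M] {ν : (n : ℕ) → ZMod (p ^ n) → M}
    (hdist : ∀ (n : ℕ) (a : ZMod (p ^ n)),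
      ∑ b ∈ univ.filter (fun b : ZMod (p ^ (n + 1)) ↦
        ZMod.castHom (pow_dvd_pow p n.le_succ) (ZMod (p ^ n)) b = a), ν (n + 1) b = ν n a)
    {n L : ℕ} (h : n ≤ L) (a : ZMod (p ^ n)) :
    ∑ b ∈ univ.filter (fun b : ZMod (p ^ L) ↦
      ZMod.castHom (pow_dvd_pow p h) (ZMod (p ^ n)) b = a), ν L b = ν n a := by
  classical
  induction L, h using Nat.le_induction with
  | base =>
    rw [ZMod.castHom_self]
    simp [Finset.filter_eq']
  | succ L hL ih =>
    rw [← ih, ← Finset.sum_fiberwise_of_maps_to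
      (s := univ.filter (fun b : ZMod (p ^ (L + 1)) ↦
        ZMod.castHom (pow_dvd_pow p (hL.trans L.le_succ)) (ZMod (p ^ n)) b = a))
      (t := univ.filter (fun b : ZMod (p ^ L) ↦
        ZMod.castHom (pow_dvd_pow p hL) (ZMod (p ^ n)) b = a))
      (g := ZMod.castHom (pow_dvd_pow p L.le_succ) (ZMod (p ^ L)))]
    · refine Finset.sum_congr rfl fun y hy ↦ ?_
      rw [← hdist L y]
      refine Finset.sum_congr ?_ fun _ _ ↦ rfl
      ext x
      simp only [Finset.mem_filter, Finset.mem_univ, true_and, and_iff_right_iff_imp]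
      intro hx
      rw [← (Finset.mem_filter.mp hy).2, ← hx, castHom_castHom_zmod]
    · intro x hx
      simp only [Finset.mem_filter, Finset.mem_univ, true_and] at hx ⊢
      rw [castHom_castHom_zmod]
      exact hx

/-- **From level `p^L` to level `p^m` on units** (any commutative ring of values): for `1 ≤ m ≤ L`
and a weight `g` on `ℤ/p^m`, `∑_{u ∈ (ℤ/p^L)^×} ν(u + p^L) g(u mod p^m) = ∑_{a ∈ (ℤ/p^m)^×} ν(a + p^m) g(a)`
(the units over a unit class are all the classes over it; iterated distribution relation)
(Mazur–Tate–Teitelbaum 1986, §I.11–§I.13; the tree's `sum_units_mul_of_distribution`, verbatim).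
[cite: MazurTateTeitelbaum1986Invent, §I.13] -/
theorem sum_units_mul_of_distribution' {R : Type*} [CommRing R] {ν : (n : ℕ) → ZMod (p ^ n) → R}
    (hdist : ∀ (n : ℕ) (a : ZMod (p ^ n)),
      ∑ b ∈ univ.filter (fun b : ZMod (p ^ (n + 1)) ↦
        ZMod.castHom (pow_dvd_pow p n.le_succ) (ZMod (p ^ n)) b = a), ν (n + 1) b = ν n a)
    {m L : ℕ} (hm : 1 ≤ m) (h : m ≤ L) (g : ZMod (p ^ m) → R) :
    ∑ u : (ZMod (p ^ L))ˣ, ν L u * g (ZMod.castHom (pow_dvd_pow p h) (ZMod (p ^ m)) u) =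
      ∑ a : (ZMod (p ^ m))ˣ, ν m a * g a := by
  classical
  haveI : NeZero (p ^ L) := ⟨pow_ne_zero _ (Fact.out : p.Prime).ne_zero⟩
  haveI : NeZero (p ^ m) := ⟨pow_ne_zero _ (Fact.out : p.Prime).ne_zero⟩
  rw [sum_units_eq_sum_filter_isUnit (F := fun b : ZMod (p ^ L) ↦ ν L b *
      g (ZMod.castHom (pow_dvd_pow p h) (ZMod (p ^ m)) b)),
    sum_units_eq_sum_filter_isUnit (F := fun a : ZMod (p ^ m) ↦ ν m a * g a),
    ← Finset.sum_fiberwise (univ.filter fun b : ZMod (p ^ L) ↦ IsUnit b)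
      (ZMod.castHom (pow_dvd_pow p h) (ZMod (p ^ m))), Finset.sum_filter]
  refine Finset.sum_congr rfl fun a _ ↦ ?_
  split_ifs with ha
  · have hfil : (univ.filter fun b : ZMod (p ^ L) ↦ IsUnit b).filter
        (fun b ↦ ZMod.castHom (pow_dvd_pow p h) (ZMod (p ^ m)) b = a) =
        univ.filter (fun b ↦ ZMod.castHom (pow_dvd_pow p h) (ZMod (p ^ m)) b = a) := by
      ext b
      simp only [Finset.mem_filter, Finset.mem_univ, true_and, and_iff_right_iff_imp]
      intro hb
      rw [isUnit_iff_isUnit_castHom hm h, hb]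
      exact ha
    rw [hfil, ← sum_fiber_of_distribution' hdist h a, Finset.sum_mul]
    refine Finset.sum_congr rfl fun b hb ↦ ?_
    rw [(Finset.mem_filter.mp hb).2]
  · refine Finset.sum_eq_zero fun b hb ↦ ?_
    simp only [Finset.mem_filter, Finset.mem_univ, true_and] at hb
    exact absurd (hb.2 ▸ (isUnit_iff_isUnit_castHom hm h b).mp hb.1) ha

variable {α : ℂ_[p]} {Φ : ℚ → ℂ_[p]} {ν : (n : ℕ) → ZMod (p ^ n) → ℂ_[p]}

/-- **The distribution relation of the allowable-root ball values** `ν(a + p^Lℤ_p) = α^{-L} Φ(a/p^L)`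
(Mazur–Tate–Teitelbaum 1986, §I.10 Prop. (10.2), case `ε(p) = 0`): the classes over `a mod pⁿ` are
`a + pⁿ j`, `j < p` (tree `filter_castHom_eq_image`), and with `x = a/pⁿ`,
`∑_j α^{-(n+1)} Φ((x + j)/p) = α^{-(n+1)} α Φ(x) = α^{-n} Φ(x)` by the `U_p`-eigen relation (S2).
[cite: MazurTateTeitelbaum1986Invent, §I.10 Prop. (10.2)] -/
theorem sum_fiber_symbolMeasure_succ (heig : ∀ r : ℚ, ∑ j : Fin p, Φ ((r + j) / p) = α * Φ r)
    (hα : α ≠ 0) (hν : ∀ (L : ℕ) (a : ZMod (p ^ L)), ν L a = α⁻¹ ^ L * Φ ((a.val : ℚ) / (p : ℚ) ^ L))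
    (n : ℕ) (a : ZMod (p ^ n)) :
    ∑ b ∈ univ.filter (fun b : ZMod (p ^ (n + 1)) ↦
        ZMod.castHom (pow_dvd_pow p n.le_succ) (ZMod (p ^ n)) b = a), ν (n + 1) b = ν n a := by
  classical
  have hp : p.Prime := Fact.out
  have hp0 : (p : ℚ) ≠ 0 := by exact_mod_cast hp.ne_zero
  have hinj : Function.Injective
      (fun j : Fin p ↦ ((a.val + p ^ n * (j : ℕ) : ℕ) : ZMod (p ^ (n + 1)))) := by
    intro j j' h
    have hv := congr_arg ZMod.val h
    simp only [val_classLift] at hv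
    exact Fin.ext (Nat.eq_of_mul_eq_mul_left (pow_pos hp.pos n) (by omega))
  rw [filter_castHom_eq_image, Finset.sum_image fun j _ j' _ h ↦ hinj h]
  set x : ℚ := (a.val : ℚ) / (p : ℚ) ^ n with hx
  have hA : ∀ j : Fin p, ((a.val + p ^ n * (j : ℕ) : ℕ) : ℚ) / (p : ℚ) ^ (n + 1) = (x + j) / p := by
    intro j
    rw [hx]
    push_cast
    field_simp
    ring
  simp only [hν, val_classLift, hA, ← Finset.mul_sum, heig x]
  rw [pow_succ, mul_assoc, inv_mul_cancel_left₀ hα]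

/-! ### §2 The `η̄`-twisted push-forward to `Γ` over the Teichmüller classes is additive -/

/-- **Two-step reduction of a fibre**: for `k ≤ K ≤ K'` the classes mod `p^{K'}` over `v mod p^k` are
grouped by their reduction mod `p^K`, which again lies over `v` (reductions compose). [folklore] -/
theorem sum_filter_castHom_eq_sum_fiber {M : Type*} [AddCommMonoid M] {k K K' : ℕ} (hk : k ≤ K)
    (hK : K ≤ K') (v : ZMod (p ^ k)) (G : ZMod (p ^ K') → M) :
    ∑ b ∈ univ.filter (fun b : ZMod (p ^ K') ↦
        ZMod.castHom (pow_dvd_pow p (hk.trans hK)) (ZMod (p ^ k)) b = v), G b =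
      ∑ u ∈ univ.filter (fun u : ZMod (p ^ K) ↦ ZMod.castHom (pow_dvd_pow p hk) (ZMod (p ^ k)) u = v),
        ∑ b ∈ univ.filter (fun b : ZMod (p ^ K') ↦
          ZMod.castHom (pow_dvd_pow p hK) (ZMod (p ^ K)) b = u), G b := by
  classical
  rw [← Finset.sum_fiberwise_of_maps_to
    (s := univ.filter (fun b : ZMod (p ^ K') ↦
      ZMod.castHom (pow_dvd_pow p (hk.trans hK)) (ZMod (p ^ k)) b = v))
    (t := univ.filter (fun u : ZMod (p ^ K) ↦ ZMod.castHom (pow_dvd_pow p hk) (ZMod (p ^ k)) u = v))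
    (g := ZMod.castHom (pow_dvd_pow p hK) (ZMod (p ^ K)))]
  · refine Finset.sum_congr rfl fun u hu ↦ Finset.sum_congr ?_ fun _ _ ↦ rfl
    ext b
    simp only [Finset.mem_filter, Finset.mem_univ, true_and, and_iff_right_iff_imp]
    intro hb
    rw [← (Finset.mem_filter.mp hu).2, ← hb, castHom_castHom_zmod]
  · intro b hb
    simp only [Finset.mem_filter, Finset.mem_univ, true_and] at hb ⊢
    rw [castHom_castHom_zmod]
    exact hb

/-- **The lifts of a Teichmüller class, summed**: for a Teichmüller representative `ζ` and `s mod pⁿ`,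
summing `H` over the classes `classOf (n+1) ζ t`, `t ≡ s (mod pⁿ)`, is summing `H` over all classes
mod `p^{n+1+e₀}` reducing to `classOf n ζ s` — these are the same classes (tree `castHom_classOf`,
`exists_lift_classOf`, `classOf_injective`; Washington §7.2). [folklore] -/
theorem sum_filter_classOf_succ (n : ℕ) (ζ : rootsOfUnity (torsionOrder p) ℤ_[p]) (s : ZMod (p ^ n))
    {M : Type*} [AddCommMonoid M] (H : ZMod (p ^ (n + 1 + cyclotomicExponent p)) → M) :
    ∑ t ∈ univ.filter (fun t : ZMod (p ^ (n + 1)) ↦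
        ZMod.castHom (pow_dvd_pow p n.le_succ) (ZMod (p ^ n)) t = s), H (classOf p (n + 1) ζ t) =
      ∑ u ∈ univ.filter (fun u : ZMod (p ^ (n + 1 + cyclotomicExponent p)) ↦
        ZMod.castHom (pow_dvd_pow p (by omega : n + cyclotomicExponent p ≤ n + 1 + cyclotomicExponent p))
          (ZMod (p ^ (n + cyclotomicExponent p))) u = classOf p n ζ s), H u := by
  refine Finset.sum_bij (fun t _ ↦ classOf p (n + 1) ζ t) (fun t ht ↦ ?_) (fun t₁ _ t₂ _ h ↦ ?_)
    (fun u hu ↦ ?_) (fun _ _ ↦ rfl)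
  · simp only [Finset.mem_filter, Finset.mem_univ, true_and] at ht ⊢
    rw [castHom_classOf, ht]
  · exact (classOf_injective (n + 1) h).2
  · simp only [Finset.mem_filter, Finset.mem_univ, true_and] at hu
    obtain ⟨t, ht, htu⟩ := exists_lift_classOf n ζ s hu
    exact ⟨t, by simp only [Finset.mem_filter, Finset.mem_univ, true_and]; exact ht, htu⟩

variable {c : ℕ} {η : DirichletCharacter ℂ_[p] (p ^ c)} {L : (n : ℕ) → ZMod (p ^ n) → ℂ_[p]}

/-- **Additivity of the twisted push-forward.**  Let `ν` be any distribution on `ℤ_p` (ball values with the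
distribution relation) and define the level-`n` ball values on `Γ` by the push-forward along
`x ↦ ⟨x⟩` of `η̄ · ν|_{ℤ_p^×}`, resolved at the level `p^{n+e₀+c}` where `η` (mod `p^c`) is constant:
`L(γ^s Γ^{pⁿ}) = ∑_ζ ∑_{b mod p^{n+e₀+c}, b ≡ ζγ^s (p^{n+e₀})} η(b)⁻¹ ν(b + p^{n+e₀+c}ℤ_p)` (`ζ` over the
Teichmüller representatives; `{x : ⟨x⟩ ∈ γ^sΓ^{pⁿ}} = ⊔_ζ (ζγ^s + p^{n+e₀}ℤ_p)`).  Then `L` is additive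
(`IsGammaDistribution`): the sub-balls of `γ^sΓ^{pⁿ}` pull back to the lifts of the classes `ζγ^s`
(`sum_filter_classOf_succ`), and on each class mod `p^{n+e₀+c}` the weight `η⁻¹` is constant while `ν`
is additive (Mazur–Tate–Teitelbaum 1986, §I.11 and §I.13). [cite: MazurTateTeitelbaum1986Invent, §I.13] -/
theorem isGammaDistribution_pushforward
    (hdist : ∀ (n : ℕ) (a : ZMod (p ^ n)),
      ∑ b ∈ univ.filter (fun b : ZMod (p ^ (n + 1)) ↦
        ZMod.castHom (pow_dvd_pow p n.le_succ) (ZMod (p ^ n)) b = a), ν (n + 1) b = ν n a)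
    (hL : ∀ (n : ℕ) (s : ZMod (p ^ n)), L n s =
      ∑ᶠ ζ : rootsOfUnity (torsionOrder p) ℤ_[p],
        ∑ b ∈ univ.filter (fun b : ZMod (p ^ (n + cyclotomicExponent p + c)) ↦
          ZMod.castHom (pow_dvd_pow p (Nat.le_add_right _ c)) (ZMod (p ^ (n + cyclotomicExponent p))) b =
            classOf p n ζ s),
          (η (ZMod.castHom (pow_dvd_pow p (Nat.le_add_left c _)) (ZMod (p ^ c)) b))⁻¹ *
            ν (n + cyclotomicExponent p + c) b) :
    IsGammaDistribution p L := by
  classical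
  haveI := neZero_torsionOrder p
  haveI := Fintype.ofFinite (rootsOfUnity (torsionOrder p) ℤ_[p])
  intro n s
  simp only [hL, finsum_eq_sum_of_fintype]
  rw [Finset.sum_comm]
  refine Finset.sum_congr rfl fun ζ _ ↦ ?_
  -- the level-`(n+1)` sub-balls: union over the lifts `classOf (n+1) ζ t` of `classOf n ζ s`
  have hle₁ : n + cyclotomicExponent p ≤ n + 1 + cyclotomicExponent p := by omega
  have hle₂ : n + 1 + cyclotomicExponent p ≤ n + 1 + cyclotomicExponent p + c := Nat.le_add_right _ c
  rw [sum_filter_classOf_succ n ζ s (fun u ↦ ∑ b ∈ univ.filter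
      (fun b : ZMod (p ^ (n + 1 + cyclotomicExponent p + c)) ↦
        ZMod.castHom (pow_dvd_pow p hle₂) (ZMod (p ^ (n + 1 + cyclotomicExponent p))) b = u),
      (η (ZMod.castHom (pow_dvd_pow p (Nat.le_add_left c _)) (ZMod (p ^ c)) b))⁻¹ *
        ν (n + 1 + cyclotomicExponent p + c) b),
    ← sum_filter_castHom_eq_sum_fiber hle₁ hle₂ (classOf p n ζ s)
      (fun b : ZMod (p ^ (n + 1 + cyclotomicExponent p + c)) ↦
        (η (ZMod.castHom (pow_dvd_pow p (Nat.le_add_left c _)) (ZMod (p ^ c)) b))⁻¹ *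
          ν (n + 1 + cyclotomicExponent p + c) b)]
  -- regroup the classes mod `p^{n+1+e₀+c}` over `classOf n ζ s` by their reduction mod `p^{n+e₀+c}`
  have hle₃ : n + cyclotomicExponent p ≤ n + cyclotomicExponent p + c := Nat.le_add_right _ c
  have hle₄ : n + cyclotomicExponent p + c ≤ n + 1 + cyclotomicExponent p + c := by omega
  have hfib := sum_filter_castHom_eq_sum_fiber hle₃ hle₄ (classOf p n ζ s)
    (fun b : ZMod (p ^ (n + 1 + cyclotomicExponent p + c)) ↦
      (η (ZMod.castHom (pow_dvd_pow p (Nat.le_add_left c _)) (ZMod (p ^ c)) b))⁻¹ *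
        ν (n + 1 + cyclotomicExponent p + c) b)
  have hsub : (ZMod.castHom (pow_dvd_pow p (hle₃.trans hle₄)) (ZMod (p ^ (n + cyclotomicExponent p))) :
      ZMod (p ^ (n + 1 + cyclotomicExponent p + c)) →+* ZMod (p ^ (n + cyclotomicExponent p))) =
      ZMod.castHom (pow_dvd_pow p (hle₁.trans hle₂)) (ZMod (p ^ (n + cyclotomicExponent p))) :=
    Subsingleton.elim _ _
  rw [hsub] at hfib
  rw [hfib]
  refine Finset.sum_congr rfl fun b' _ ↦ ?_
  -- on the fibre of `b'` the weight `η(· mod p^c)⁻¹` is constant and `ν` is additive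
  have hc : c ≤ n + cyclotomicExponent p + c := Nat.le_add_left c _
  have hconst : ∀ b ∈ univ.filter (fun b : ZMod (p ^ (n + 1 + cyclotomicExponent p + c)) ↦
      ZMod.castHom (pow_dvd_pow p hle₄) (ZMod (p ^ (n + cyclotomicExponent p + c))) b = b'),
      (η (ZMod.castHom (pow_dvd_pow p (Nat.le_add_left c _)) (ZMod (p ^ c)) b))⁻¹ *
          ν (n + 1 + cyclotomicExponent p + c) b =
        (η (ZMod.castHom (pow_dvd_pow p hc) (ZMod (p ^ c)) b'))⁻¹ *
          ν (n + 1 + cyclotomicExponent p + c) b := by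
    intro b hb
    rw [← (Finset.mem_filter.mp hb).2, castHom_castHom_zmod]
  rw [Finset.sum_congr rfl hconst, ← Finset.mul_sum, sum_fiber_of_distribution' hdist hle₄ b']

/-! ### §3 Growth of order `½` from a bounded symbol and `‖α⁻¹‖ ≤ √p` -/

/-- The ball values `α^{-L} Φ(a/p^L)` of a BOUNDED symbol (`‖Φ‖ ≤ C`) with `‖α⁻¹‖ ≤ p^{1/2}` satisfy
`‖ν(a + p^Lℤ_p)‖ ≤ C p^{L/2}` (Mazur–Tate–Teitelbaum 1986, §I.11: "`h`-admissible" with `h = v_p(α)`).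
[cite: MazurTateTeitelbaum1986Invent, §I.11] -/
theorem norm_symbolMeasure_le {C : ℝ} (hbd : ∀ r : ℚ, ‖Φ r‖ ≤ C)
    (hαn : ‖α⁻¹‖ ≤ (p : ℝ) ^ (1 / 2 : ℝ))
    (hν : ∀ (L : ℕ) (a : ZMod (p ^ L)), ν L a = α⁻¹ ^ L * Φ ((a.val : ℚ) / (p : ℚ) ^ L))
    (L : ℕ) (a : ZMod (p ^ L)) : ‖ν L a‖ ≤ C * (p : ℝ) ^ ((1 / 2 : ℝ) * L) := by
  have hp0 : (0 : ℝ) < p := by exact_mod_cast (Fact.out : p.Prime).pos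
  have hC0 : 0 ≤ C := (norm_nonneg _).trans (hbd 0)
  rw [hν, norm_mul, norm_pow, mul_comm]
  refine mul_le_mul (hbd _) ?_ (by positivity) hC0
  calc ‖α⁻¹‖ ^ L ≤ ((p : ℝ) ^ (1 / 2 : ℝ)) ^ L := pow_le_pow_left₀ (norm_nonneg _) hαn L
    _ = (p : ℝ) ^ ((1 / 2 : ℝ) * L) := by rw [← Real.rpow_natCast, ← Real.rpow_mul hp0.le]

/-- `‖η(x)⁻¹‖ ≤ 1` for a Dirichlet character with values in `ℂ_p`: `η(x)` is `0` (then `0⁻¹ = 0`) or,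
at a unit, of norm `1` (Mathlib `DirichletCharacter.unit_norm_eq_one`). [folklore] -/
theorem norm_inv_apply_le_one (η : DirichletCharacter ℂ_[p] (p ^ c)) (x : ZMod (p ^ c)) :
    ‖(η x)⁻¹‖ ≤ 1 := by
  by_cases hx : IsUnit x
  · rw [← hx.unit_spec, norm_inv, η.unit_norm_eq_one, inv_one]
  · rw [η.map_nonunit hx, inv_zero, norm_zero]
    exact zero_le_one

/-- **Growth of order `½` of the twisted push-forward**: every summand `η(b)⁻¹ ν(b + p^{n+e₀+c}ℤ_p)` has
norm `≤ C p^{(n+e₀+c)/2}` (`‖η(b)⁻¹‖ ≤ 1`: a value of a Dirichlet character is `0` or of norm `1`), and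
`ℂ_p` is ultrametric; so `‖L(γ^sΓ^{pⁿ})‖ ≤ (C p^{(e₀+c)/2}) · p^{n/2}` — `HasGrowthOrder p (1/2)`, Bellaïche's
"order `≤ ½`" (Def. 6.2.10 with `k = 0`). [cite: Bellaiche2021, Def. 6.2.10] [cite: MazurTateTeitelbaum1986Invent, §I.11] -/
theorem hasGrowthOrder_pushforward {C : ℝ} (hbd : ∀ r : ℚ, ‖Φ r‖ ≤ C)
    (hαn : ‖α⁻¹‖ ≤ (p : ℝ) ^ (1 / 2 : ℝ))
    (hν : ∀ (L : ℕ) (a : ZMod (p ^ L)), ν L a = α⁻¹ ^ L * Φ ((a.val : ℚ) / (p : ℚ) ^ L))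
    (hL : ∀ (n : ℕ) (s : ZMod (p ^ n)), L n s =
      ∑ᶠ ζ : rootsOfUnity (torsionOrder p) ℤ_[p],
        ∑ b ∈ univ.filter (fun b : ZMod (p ^ (n + cyclotomicExponent p + c)) ↦
          ZMod.castHom (pow_dvd_pow p (Nat.le_add_right _ c)) (ZMod (p ^ (n + cyclotomicExponent p))) b =
            classOf p n ζ s),
          (η (ZMod.castHom (pow_dvd_pow p (Nat.le_add_left c _)) (ZMod (p ^ c)) b))⁻¹ *
            ν (n + cyclotomicExponent p + c) b) :
    HasGrowthOrder p (1 / 2) L := by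
  classical
  haveI := neZero_torsionOrder p
  haveI := Fintype.ofFinite (rootsOfUnity (torsionOrder p) ℤ_[p])
  have hp0 : (0 : ℝ) < p := by exact_mod_cast (Fact.out : p.Prime).pos
  have hC0 : 0 ≤ C := (norm_nonneg _).trans (hbd 0)
  refine ⟨C * (p : ℝ) ^ ((1 / 2 : ℝ) * (cyclotomicExponent p + c : ℕ)), fun n s ↦ ?_⟩
  have hK : C * (p : ℝ) ^ ((1 / 2 : ℝ) * (cyclotomicExponent p + c : ℕ)) * (p : ℝ) ^ ((1 / 2 : ℝ) * n) =
      C * (p : ℝ) ^ ((1 / 2 : ℝ) * (n + cyclotomicExponent p + c : ℕ)) := by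
    rw [mul_assoc, ← Real.rpow_add hp0]
    push_cast
    ring_nf
  rw [hK, hL, finsum_eq_sum_of_fintype]
  refine IsUltrametricDist.norm_sum_le_of_forall_le_of_nonneg (by positivity) fun ζ _ ↦ ?_
  refine IsUltrametricDist.norm_sum_le_of_forall_le_of_nonneg (by positivity) fun b _ ↦ ?_
  rw [norm_mul]
  calc _ ≤ 1 * (C * (p : ℝ) ^ ((1 / 2 : ℝ) * (n + cyclotomicExponent p + c : ℕ))) :=
        mul_le_mul (norm_inv_apply_le_one η _) (norm_symbolMeasure_le hbd hαn hν _ b) (norm_nonneg _)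
          zero_le_one
    _ = _ := one_mul _

end Summit.BirchSwinnertonDyer.BirchSwinnertonDyer.Theorems.PSUntwistExistence

end
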